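import Summits.AtomisticToContinuum.Crystallization.Theorems.HullExactificationCascadeRobustBarlowTemplateCoveringCriterion
import Mathlib.Analysis.Calculus.InverseFunctionTheorem.ApproximatesLinearOn
import Mathlib.Analysis.Normed.Module.FiniteDimension

/-!
# `stub_globalInverse` for line `mtp-prestress-split-ergodic-frame` (crux `LayeredLawsSelectHcp`, stmt-AtomisticToContinuum-9226)

**Statement (global inverse function theorem for maps uniformly locally close to similarities;
Hadamard / F. John 1968 / Plastock 1974 in classical dress).**  Let `F : ℝ³ → ℝ³`, `0 < r`,
`0 ≤ δ < 1`, `0 < m`, and suppose that on EVERY ball `ball y r` there are a ratio `a ≥ m` and a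
linear isometry `A` with `‖(F p - F q) - a • (A p - A q)‖ ≤ δ a ‖p - q‖` for `p, q ∈ ball y r`.
Then `F` is a bijection of `ℝ³` and globally `(1 - δ) m`-co-Lipschitz:
`(1 - δ) m ‖p - q‖ ≤ ‖F p - F q‖` for all `p, q`.

**Proof.**
* `globalInverse_local` — the local analysis on one ball, via Mathlib's `ApproximatesLinearOn`
  toolkit applied to the continuous linear map `T := a • A` with the (linear) right inverse
  `a⁻¹ • A⁻¹` of norm `a⁻¹ > δ a`: on `ball y r` the map `F` is `(1 - δ) a`-co-Lipschitz (reverse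
  triangle inequality), `ball (F y) ((1 - δ) a r / 2) ⊆ F '' ball y r`
  (`surjOn_closedBall_of_nonlinearRightInverse` on `closedBall y (r/2)`), and
  `map F (𝓝 y) = 𝓝 (F y)` (`map_nhds_eq`).
* `stub_globalInverse` — hence `F` is continuous, open, injective on `r`-balls, and images of
  `r`-balls contain the concentric `(1 - δ) m r / 2`-balls, so the LANDED covering criterion
  `HullExactificationCascadeRobustBarlowTemplate.develop_coveringCriterion` makes `F` bijective.
  Its inverse `G` is locally `((1 - δ) m)⁻¹`-Lipschitz at the uniform scale `(1 - δ) m r / 2`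
  (local surjectivity + local injectivity at the centre `G z`), and chaining along the straight
  segment `[F q, F p]` in `N` equal steps shorter than that scale (induction on the number of
  steps) gives the global co-Lipschitz bound.
-/

noncomputable section

namespace Summit.AtomisticToContinuum.Crystallization.Theorems.PalmUnimodularRigidity.LayeredLawsSelectHcp

open Summit.AtomisticToContinuum.Crystallization.Theorems.HullExactificationCascadeRobustBarlowTemplate
  (develop_coveringCriterion)

/-- **Local analysis on one ball.**  If `‖(F p - F q) - a • (A p - A q)‖ ≤ δ a ‖p - q‖` for
`p, q ∈ ball y r` (`A` a linear isometry, `a > 0`, `0 ≤ δ < 1`), then on that ball `F` is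
`(1 - δ) a`-co-Lipschitz, the image of the ball contains `ball (F y) ((1 - δ) a (r / 2))`, and `F`
maps the neighbourhood filter of `y` onto that of `F y`.  (Mathlib's `ApproximatesLinearOn`
toolkit applied to `T := a • A`, whose inverse `a⁻¹ • A⁻¹` has norm `a⁻¹`, and `δ a < a`.) -/
theorem globalInverse_local (F : EuclideanSpace ℝ (Fin 3) → EuclideanSpace ℝ (Fin 3))
    (A : EuclideanSpace ℝ (Fin 3) ≃ₗᵢ[ℝ] EuclideanSpace ℝ (Fin 3)) (a δ r : ℝ)
    (y : EuclideanSpace ℝ (Fin 3)) (ha : 0 < a) (hδ₀ : 0 ≤ δ) (hδ₁ : δ < 1) (hr : 0 < r)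
    (happ : ∀ p ∈ Metric.ball y r, ∀ q ∈ Metric.ball y r,
      ‖(F p - F q) - a • (A p - A q)‖ ≤ δ * a * ‖p - q‖) :
    (∀ p ∈ Metric.ball y r, ∀ q ∈ Metric.ball y r, (1 - δ) * a * ‖p - q‖ ≤ ‖F p - F q‖) ∧
      Metric.ball (F y) ((1 - δ) * a * (r / 2)) ⊆ F '' Metric.ball y r ∧
      Filter.map F (nhds y) = nhds (F y) := by
  -- the approximating continuous linear map `T := a • A`
  obtain ⟨T, hT⟩ :
      ∃ T : EuclideanSpace ℝ (Fin 3) →L[ℝ] EuclideanSpace ℝ (Fin 3), ∀ z, T z = a • A z :=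
    ⟨a • (A.toContinuousLinearEquiv : EuclideanSpace ℝ (Fin 3) →L[ℝ] EuclideanSpace ℝ (Fin 3)),
      fun z => rfl⟩
  obtain ⟨c, hc⟩ : ∃ c : NNReal, (c : ℝ) = δ * a :=
    ⟨⟨δ * a, by positivity⟩, rfl⟩
  have hf : ApproximatesLinearOn F T (Metric.ball y r) c := by
    intro p hp q hq
    rw [hT, hc, map_sub]
    exact happ p hp q hq
  -- the (linear) right inverse `a⁻¹ • A⁻¹` of `T`, of norm `a⁻¹`
  let R : T.NonlinearRightInverse :=
    { toFun := fun z => a⁻¹ • A.symm z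
      nnnorm := ⟨a⁻¹, inv_nonneg.2 ha.le⟩
      bound' := fun z => by
        rw [norm_smul, norm_inv, Real.norm_of_nonneg ha.le, LinearIsometryEquiv.norm_map]
        exact le_rfl
      right_inv' := fun z => by
        rw [hT, map_smul, smul_smul, mul_inv_cancel₀ ha.ne', one_smul]
        exact A.apply_symm_apply z }
  have hRn : (R.nnnorm : ℝ) = a⁻¹ := rfl
  have hδa : δ * a < a := by
    have h := mul_lt_mul_of_pos_right hδ₁ ha
    rwa [one_mul] at h
  have hclt : c < R.nnnorm⁻¹ := by
    rw [← NNReal.coe_lt_coe, NNReal.coe_inv, hRn, inv_inv, hc]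
    exact hδa
  refine ⟨?_, ?_, hf.map_nhds_eq R (Metric.ball_mem_nhds y hr) (Or.inr hclt)⟩
  · -- local co-Lipschitz bound, by the reverse triangle inequality
    intro p hp q hq
    have h := happ p hp q hq
    have hApq : ‖a • (A p - A q)‖ = a * ‖p - q‖ := by
      rw [norm_smul, Real.norm_of_nonneg ha.le, ← map_sub, LinearIsometryEquiv.norm_map]
    have hrev := norm_sub_norm_le (a • (A p - A q)) (F p - F q)
    rw [← norm_sub_rev (F p - F q), hApq] at hrev
    have hmul : (1 - δ) * a * ‖p - q‖ = a * ‖p - q‖ - δ * a * ‖p - q‖ := by ring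
    rw [hmul]
    linarith
  · -- local surjectivity
    intro z hz
    have hsurj := hf.surjOn_closedBall_of_nonlinearRightInverse R (b := y) (ε := r / 2)
      (by positivity) (Metric.closedBall_subset_ball (by linarith))
    rw [hRn, inv_inv, hc] at hsurj
    have hz' : z ∈ Metric.closedBall (F y) ((a - δ * a) * (r / 2)) := by
      rw [Metric.mem_closedBall]
      have hz1 := Metric.mem_ball.1 hz
      have hmul : (1 - δ) * a * (r / 2) = (a - δ * a) * (r / 2) := by ring
      linarith
    obtain ⟨w, hw, hwz⟩ := hsurj hz'
    exact ⟨w, Metric.closedBall_subset_ball (by linarith) hw, hwz⟩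

/-- **STUB S2 `stub_globalInverse` — global inverse function theorem for maps uniformly locally
close to similarities.**  If `F : ℝ³ → ℝ³` is, on EVERY ball of a fixed radius `r`, within
relative Lipschitz defect `δ < 1` of a similarity `a • A` (`A` a linear isometry, ratio
`a ≥ m > 0`, both allowed to depend on the ball), then `F` is a bijection of `ℝ³` and GLOBALLY
`(1 − δ) m`-co-Lipschitz.  Proof: by `globalInverse_local`, `F` is continuous, open, injective and
`(1 − δ) m`-co-Lipschitz on `r`-balls, and images of `r`-balls contain the concentric
`(1 − δ) m r / 2`-balls; the covering criterion `develop_coveringCriterion` gives bijectivity; the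
inverse is `((1 − δ) m)⁻¹`-Lipschitz at scale `(1 − δ) m r / 2`, and chaining along the straight
segment `[F q, F p]` in equal steps shorter than that scale gives the global bound.
Hadamard / F. John 1968 / Plastock 1974. [folklore] -/
theorem stub_globalInverse :
    ∀ (F : EuclideanSpace ℝ (Fin 3) → EuclideanSpace ℝ (Fin 3)) (r δ m : ℝ), 0 < r → 0 ≤ δ → δ < 1 → 0 < m →
      (∀ y : EuclideanSpace ℝ (Fin 3), ∃ a : ℝ, m ≤ a ∧ ∃ A : EuclideanSpace ℝ (Fin 3) ≃ₗᵢ[ℝ] EuclideanSpace ℝ (Fin 3),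
        ∀ p ∈ Metric.ball y r, ∀ q ∈ Metric.ball y r, ‖(F p - F q) - a • (A p - A q)‖ ≤ δ * a * ‖p - q‖) →
      Function.Bijective F ∧ ∀ p q : EuclideanSpace ℝ (Fin 3), (1 - δ) * m * ‖p - q‖ ≤ ‖F p - F q‖ := by
  intro F r δ m hr hδ₀ hδ₁ hm hyp
  -- the uniform co-Lipschitz constant `K` and covering radius `K * (r / 2)`
  obtain ⟨K, hK⟩ : ∃ K : ℝ, K = (1 - δ) * m := ⟨_, rfl⟩
  have hKpos : 0 < K := by rw [hK]; exact mul_pos (by linarith) hm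
  have hcpos : 0 < K * (r / 2) := by positivity
  have hloc : ∀ y : EuclideanSpace ℝ (Fin 3),
      (∀ p ∈ Metric.ball y r, ∀ q ∈ Metric.ball y r, K * ‖p - q‖ ≤ ‖F p - F q‖) ∧
      Metric.ball (F y) (K * (r / 2)) ⊆ F '' Metric.ball y r ∧
      Filter.map F (nhds y) = nhds (F y) := by
    intro y
    obtain ⟨a, hma, A, happ⟩ := hyp y
    have ha : 0 < a := lt_of_lt_of_le hm hma
    obtain ⟨h1, h2, h3⟩ := globalInverse_local F A a δ r y ha hδ₀ hδ₁ hr happ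
    have hKa : K ≤ (1 - δ) * a := by
      rw [hK]; exact mul_le_mul_of_nonneg_left hma (by linarith)
    refine ⟨fun p hp q hq => le_trans ?_ (h1 p hp q hq),
      Set.Subset.trans (Metric.ball_subset_ball ?_) h2, h3⟩
    · exact mul_le_mul_of_nonneg_right hKa (norm_nonneg _)
    · exact mul_le_mul_of_nonneg_right hKa (by positivity)
  have hcont : Continuous F := continuous_iff_continuousAt.2 fun y => (hloc y).2.2.le
  have hopen : IsOpenMap F := isOpenMap_iff_nhds_le.2 fun y => (hloc y).2.2.ge
  have hinj : ∀ y : EuclideanSpace ℝ (Fin 3), Set.InjOn F (Metric.ball y r) := by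
    intro y p hp q hq hpq
    have h := (hloc y).1 p hp q hq
    rw [hpq, sub_self, norm_zero] at h
    have h0 : ‖p - q‖ ≤ 0 := le_of_mul_le_mul_left (by rwa [mul_zero]) hKpos
    exact sub_eq_zero.1 (norm_eq_zero.1 (le_antisymm h0 (norm_nonneg _)))
  have hbij : Function.Bijective F :=
    develop_coveringCriterion F r (K * (r / 2)) hcont hopen hr hcpos hinj fun y => (hloc y).2.1
  refine ⟨hbij, ?_⟩
  -- the inverse `G` and its local Lipschitz bound at scale `K * (r / 2)`
  obtain ⟨G, hGl, hGr⟩ := Function.bijective_iff_has_inverse.1 hbij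
  have hGloc : ∀ z w : EuclideanSpace ℝ (Fin 3), ‖w‖ < K * (r / 2) →
      K * ‖G (z + w) - G z‖ ≤ ‖w‖ := by
    intro z w hw
    have hmem : z + w ∈ Metric.ball (F (G z)) (K * (r / 2)) := by
      rw [Metric.mem_ball, hGr z, dist_eq_norm, add_sub_cancel_left]
      exact hw
    obtain ⟨x, hx, hxz⟩ := (hloc (G z)).2.1 hmem
    have hGx : G (z + w) = x := by rw [← hxz, hGl x]
    have h := (hloc (G z)).1 x hx (G z) (Metric.mem_ball_self hr)
    rw [hxz, hGr z, add_sub_cancel_left] at h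
    rw [hGx]
    exact h
  -- chaining `n` steps of a short increment `w`
  have hchain : ∀ (n : ℕ) (z w : EuclideanSpace ℝ (Fin 3)), ‖w‖ < K * (r / 2) →
      K * ‖G (z + (n : ℝ) • w) - G z‖ ≤ n * ‖w‖ := by
    intro n
    induction n with
    | zero =>
      intro z w _
      simp
    | succ n ih =>
      intro z w hw
      have hstep := hGloc (z + (n : ℝ) • w) w hw
      have hprev := ih z w hw
      have hsplit : G (z + ((n + 1 : ℕ) : ℝ) • w) - G z =
          (G (z + (n : ℝ) • w + w) - G (z + (n : ℝ) • w)) + (G (z + (n : ℝ) • w) - G z) := by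
        rw [Nat.cast_succ, add_smul, one_smul, add_assoc]
        abel
      rw [hsplit]
      calc K * ‖(G (z + (n : ℝ) • w + w) - G (z + (n : ℝ) • w)) + (G (z + (n : ℝ) • w) - G z)‖
          ≤ K * (‖G (z + (n : ℝ) • w + w) - G (z + (n : ℝ) • w)‖ + ‖G (z + (n : ℝ) • w) - G z‖) :=
            mul_le_mul_of_nonneg_left (norm_add_le _ _) hKpos.le
        _ ≤ ‖w‖ + n * ‖w‖ := by rw [mul_add]; exact add_le_add hstep hprev
        _ = ((n + 1 : ℕ) : ℝ) * ‖w‖ := by push_cast; ring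
  -- the global Lipschitz bound for `G`
  have hGglob : ∀ z w : EuclideanSpace ℝ (Fin 3), K * ‖G (z + w) - G z‖ ≤ ‖w‖ := by
    intro z w
    obtain ⟨N, hN⟩ := exists_nat_gt (‖w‖ / (K * (r / 2)))
    have hNpos : (0 : ℝ) < N := lt_of_le_of_lt (by positivity) hN
    have hNne : (N : ℝ) ≠ 0 := hNpos.ne'
    have hw' : ‖(N : ℝ)⁻¹ • w‖ < K * (r / 2) := by
      rw [norm_smul, norm_inv, Real.norm_of_nonneg hNpos.le, inv_mul_lt_iff₀ hNpos]
      rwa [div_lt_iff₀ hcpos] at hN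
    have h := hchain N z ((N : ℝ)⁻¹ • w) hw'
    rw [smul_smul, mul_inv_cancel₀ hNne, one_smul, norm_smul, norm_inv,
      Real.norm_of_nonneg hNpos.le, ← mul_assoc, mul_inv_cancel₀ hNne, one_mul] at h
    exact h
  intro p q
  have h := hGglob (F q) (F p - F q)
  rw [add_sub_cancel, hGl p, hGl q] at h
  rw [← hK]
  exact h

end Summit.AtomisticToContinuum.Crystallization.Theorems.PalmUnimodularRigidity.LayeredLawsSelectHcp

end
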